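import Literature.NumberTheory.ConnesConsani2024.ProlateWaveMoments
import Literature.Analysis.Complex.CahenMellinSector
import Mathlib.Analysis.SpecialFunctions.Gamma.Beta
import Mathlib.Analysis.SpecialFunctions.Sigmoid
import Mathlib.Analysis.Fourier.Inversion
import HarnessLib

/-!
# Connes–Consani–Moscovici 2024, §5.2, Proposition «(moments1)» — DISCHARGED:
# the measure `(2π)^{−3/2}|Γ(¼ + is/2)|² ds` is a probability measure with characteristic function `√(2/(eˣ+e⁻ˣ))`

LINE 1 — FRAMING: RH-FREE classical special-function identity (Euler's Beta integral, the logistic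
substitution and Fourier inversion); cell rh-crit, corpus C1, seat t10 (idle-seat discharge, lead R43);
bears_on: W-C/W-P (sequel, CCM2024 §5.2; no leaf role).  WHAT THIS IS NOT: any claim about RH — nothing
here bears on the truth of RH.

Topic `NumberTheory/ConnesConsani2024`; namespace `Literature.NumberTheory.ConnesConsani2024`; theorems
only (no definition, no named fact, no instance, no `sorry`).  Companion of `ProlateWaveMoments` (seat t14),
whose named fact `CCM2024_prop_moments_sech` it proves (`CCM2024_prop_moments_sech_holds`): for the measure
`dm := gammaQuarterMeasure = (2π)^{−3/2}|Γ(¼ + is/2)|² ds` on `ℝ` (A. Connes, C. Consani, H. Moscovici,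
*Zeta zeros and prolate wave operators*, Ann. Funct. Anal. 15 (2024) = arXiv:2310.18423, §5.2, the
unnumbered Proposition «(moments1)», p0018:L121–L127 of the held text, with its proof p0018:L129–L148;
normalisation `(2π)^{−3/2}` of Thm 3.1 (ii), p0008:L139):

* `isProbabilityMeasure_gammaQuarterMeasure` (and `isProbabilityMeasure_htMeasure`, the same measure in the
  §3 spelling `htMeasure` of `ProlateWaveCyclicPairs`, i.e. the conjunct of `CCM2024_thm_3_1_ii`) —
  `dm` is a probability measure (`integral_gammaQuarterDensity`: `∫(2π)^{−3/2}|Γ(¼+is/2)|²ds = 1`);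
* `integrable_pow_gammaQuarterMeasure`, `integral_pow_gammaQuarterMeasure_of_odd` — all moments exist, the
  odd ones vanish;
* **`integral_cexp_gammaQuarterMeasure`** — `∫ e^{isx} dm(s) = √(2/(eˣ + e⁻ˣ))` for every real `x`;
* **`CCM2024_prop_moments_sech_holds : CCM2024_prop_moments_sech`**.

**Proof.** The printed proof (p0018:L129–L148) evaluates `∫e^{isx}dm(s) = ⟨e^{ixh}𝔽_μ(wξ)|𝔽_μ(wξ)⟩` by the
unitarity of the multiplicative Fourier transform `𝔽_μ` (Mellin–Plancherel), with
`𝔽_μ(wξ)(s) = ½π^{−¼+is/2}Γ(¼ − is/2)` for the Gaussian `ξ`.  The tree's Mellin–Plancherel theorem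
(`Literature.Analysis.FunctionSpaces.PlancherelL1L2.integral_norm_sq_mellin_eq`) is the norm identity only, not
the polarised/shifted pairing; we therefore take the equivalent classical road that Mathlib supports end
to end and prove the SAME identity:
1. `|Γ(¼+is/2)|² = Γ(¼+is/2)Γ(¼−is/2) = Γ(½)·B(¼+is/2, ¼−is/2)` (Euler's Beta integral, Mathlib
   `Complex.Gamma_mul_Gamma_eq_betaIntegral`), and the logistic substitution `x = σ(y) = (1+e^{−y})⁻¹`
   (Mathlib `Real.sigmoid`, `MeasureTheory.integral_image_eq_integral_abs_deriv_smul`) turns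
   `B = ∫₀¹x^{w−1}(1−x)^{w̄−1}dx` into `∫_ℝ σ(y)^w σ(−y)^{w̄} dy = ∫_ℝ (e^{y/2}+e^{−y/2})^{−1/2}e^{isy/2}dy`
   (`betaIntegral_quarter_eq_integral`), whence **`|Γ(¼+is/2)|² = 2√π ∫_ℝ (eᵛ+e⁻ᵛ)^{−1/2} e^{isv} dv`**
   (`normSq_Gamma_quarter_eq_integral`; Fourier form `normSq_Gamma_quarter_eq_fourier`,
   `fourier_sechHalf_eq`);
2. the kernel `h(v) = (eᵛ+e⁻ᵛ)^{−1/2}` is continuous, even and integrable, and `𝓕h = (2√π)⁻¹|Γ(¼ − iπξ)|²`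
   is integrable by the tree's vertical decay of `Γ` (`Literature.Analysis.Complex.exists_norm_Gamma_vertical_le`;
   here `exists_normSq_Gamma_quarter_le`, `integrable_abs_pow_mul_normSq_Gamma_quarter`), so Mathlib's
   Fourier inversion (`Continuous.fourierInv_fourier_eq`) gives
   `∫ e^{isx}|Γ(¼+is/2)|² ds = 4π^{3/2} h(x)` (`integral_normSq_Gamma_quarter_mul_exp`) and
   `(2π)^{−3/2}·4π^{3/2} = √2`;
3. `x = 0` gives the total mass `1`; the density is even in `s` (`Γ(s̄) = conj Γ(s)`), so odd moments vanish;
   all moments exist by the vertical decay.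

## References

* [ConnesConsaniMoscovici2024] A. Connes, C. Consani, H. Moscovici, *Zeta zeros and prolate wave operators*,
  Ann. Funct. Anal. 15 (2024), doi:10.1007/s43034-024-00388-z, arXiv:2310.18423, §5.2 Prop. (moments1)
  p0018:L121–L148; Thm 3.1 (ii).
* Euler's Beta integral and Fourier inversion: Mathlib (`Mathlib.Analysis.SpecialFunctions.Gamma.Beta`,
  `Mathlib.Analysis.Fourier.Inversion`). [folklore]
-/

noncomputable section

open MeasureTheory Set Real Complex Filter
open scoped FourierTransform Topology ENNReal

namespace Literature.NumberTheory.ConnesConsani2024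

open Literature.Analysis.Complex Literature.Analysis.SpecialFunctions

/-! ### `s ↦ Γ(¼ + is/2)`: continuity, conjugation symmetry, vertical decay -/

/-- `¼ + is/2` is not a pole of `Γ`. [folklore] -/
private theorem quarter_add_ne_neg_nat (s : ℝ) (m : ℕ) : (1 / 4 + I * s / 2 : ℂ) ≠ -m := by
  intro h
  have := congrArg Complex.re h
  simp at this
  linarith [m.cast_nonneg (α := ℝ)]

/-- `s ↦ Γ(¼ + is/2)` is continuous. [cite: ConnesConsaniMoscovici2024, §5.2 (moments of `|Γ(¼+is/2)|² ds`, p0018:L89–L109)] -/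
theorem continuous_Gamma_quarter : Continuous fun s : ℝ => Complex.Gamma (1 / 4 + I * s / 2) := by
  refine continuous_iff_continuousAt.2 fun s => ?_
  have h1 : ContinuousAt Complex.Gamma (1 / 4 + I * s / 2) :=
    (Complex.differentiableAt_Gamma _ (quarter_add_ne_neg_nat s)).continuousAt
  have h2 : (fun s : ℝ => Complex.Gamma (1 / 4 + I * s / 2)) =
      Complex.Gamma ∘ fun s : ℝ => (1 / 4 + I * s / 2 : ℂ) := rfl
  rw [h2]
  exact ContinuousAt.comp h1 (by fun_prop : Continuous fun s : ℝ => (1 / 4 + I * s / 2 : ℂ)).continuousAt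

/-- `‖Γ(¼ − is/2)‖ = ‖Γ(¼ + is/2)‖` (`Γ(s̄) = conj Γ(s)`). [cite: ConnesConsaniMoscovici2024, §5.2 (moments of `|Γ(¼+is/2)|² ds`, p0018:L89–L109)] -/
theorem norm_Gamma_quarter_neg (s : ℝ) :
    ‖Complex.Gamma (1 / 4 + I * ((-s : ℝ) : ℂ) / 2)‖ = ‖Complex.Gamma (1 / 4 + I * s / 2)‖ := by
  have h : (1 / 4 + I * ((-s : ℝ) : ℂ) / 2 : ℂ) = (starRingEnd ℂ) (1 / 4 + I * s / 2) := by
    simp only [map_add, map_div₀, map_mul, Complex.conj_I, Complex.conj_ofReal, map_one, map_ofNat,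
      Complex.ofReal_neg]
    ring
  rw [h, Complex.Gamma_conj, Complex.norm_conj]

/-- **Vertical decay**: `‖Γ(¼ + is/2)‖² ≤ K (1 + |s|)^N e^{−π|s|/2}` for some `K, N ≥ 0`
(from the tree's `exists_norm_Gamma_vertical_le`). [cite: ConnesConsaniMoscovici2024, §5.2 (moments of `|Γ(¼+is/2)|² ds`, p0018:L89–L109)] -/
theorem exists_normSq_Gamma_quarter_le :
    ∃ K N : ℝ, 0 ≤ K ∧ 0 ≤ N ∧ ∀ s : ℝ,
      ‖Complex.Gamma (1 / 4 + I * s / 2)‖ ^ 2 ≤ K * (1 + |s|) ^ N * Real.exp (-(π / 2 * |s|)) := by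
  obtain ⟨K, N, hK, hN, hb⟩ := exists_norm_Gamma_vertical_le (c := 1 / 4) (by norm_num)
  refine ⟨K ^ 2, 2 * N, by positivity, by positivity, fun s => ?_⟩
  have h := hb (s / 2)
  have hw : ((1 / 4 : ℝ) : ℂ) + ((s / 2 : ℝ) : ℂ) * I = 1 / 4 + I * s / 2 := by push_cast; ring
  rw [hw] at h
  have h0 : 0 ≤ ‖Complex.Gamma (1 / 4 + I * s / 2)‖ := norm_nonneg _
  have h1 : (1 + |s / 2|) ^ N ≤ (1 + |s|) ^ N := by
    refine Real.rpow_le_rpow (by positivity) ?_ hN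
    rw [abs_div, abs_two]
    linarith [abs_nonneg s]
  have h2 : ‖Complex.Gamma (1 / 4 + I * s / 2)‖ ≤ K * (1 + |s|) ^ N * Real.exp (-(π / 2 * |s / 2|)) :=
    h.trans (by gcongr)
  have h3 : 0 ≤ K * (1 + |s|) ^ N * Real.exp (-(π / 2 * |s / 2|)) := by positivity
  calc ‖Complex.Gamma (1 / 4 + I * s / 2)‖ ^ 2
      ≤ (K * (1 + |s|) ^ N * Real.exp (-(π / 2 * |s / 2|))) ^ 2 := pow_le_pow_left₀ h0 h2 2
    _ = K ^ 2 * (1 + |s|) ^ (2 * N) * Real.exp (-(π / 2 * |s|)) := by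
        rw [mul_pow, mul_pow, ← Real.exp_nat_mul, ← Real.rpow_natCast ((1 + |s|) ^ N),
          ← Real.rpow_mul (by positivity)]
        congr 2
        · norm_num; ring
        · rw [abs_div, abs_two]; push_cast; ring

/-- `|s|^n ‖Γ(¼ + is/2)‖²` is integrable on `ℝ` for every `n` (all moments of `|Γ(¼ + is/2)|² ds` exist). [cite: ConnesConsaniMoscovici2024, §5.2 (moments of `|Γ(¼+is/2)|² ds`, p0018:L89–L109)] -/
theorem integrable_abs_pow_mul_normSq_Gamma_quarter (n : ℕ) :
    Integrable fun s : ℝ => |s| ^ n * ‖Complex.Gamma (1 / 4 + I * s / 2)‖ ^ 2 := by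
  obtain ⟨K, N, hK, hN, hb⟩ := exists_normSq_Gamma_quarter_le
  have hdom := (integrable_one_add_abs_rpow_mul_exp_neg (a := π / 2) (p := n + N) (by positivity)
    (by positivity)).const_mul K
  refine hdom.mono' ?_ (Eventually.of_forall fun s => ?_)
  · exact ((continuous_abs.pow n).mul (continuous_Gamma_quarter.norm.pow 2)).aestronglyMeasurable
  · have h0 : 0 ≤ |s| ^ n := by positivity
    rw [Real.norm_of_nonneg (by positivity)]
    calc |s| ^ n * ‖Complex.Gamma (1 / 4 + I * s / 2)‖ ^ 2
        ≤ (1 + |s|) ^ (n : ℝ) * (K * (1 + |s|) ^ N * Real.exp (-(π / 2 * |s|))) := by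
          refine mul_le_mul ?_ (hb s) (by positivity) (by positivity)
          rw [Real.rpow_natCast]
          exact pow_le_pow_left₀ (abs_nonneg s) (by linarith [abs_nonneg s]) n
      _ = K * ((1 + |s|) ^ ((n : ℝ) + N) * Real.exp (-(π / 2 * |s|))) := by
          rw [Real.rpow_add (by positivity)]; ring

/-- `‖Γ(¼ + is/2)‖²` is integrable on `ℝ`. [cite: ConnesConsaniMoscovici2024, §5.2 (moments of `|Γ(¼+is/2)|² ds`, p0018:L89–L109)] -/
theorem integrable_normSq_Gamma_quarter :
    Integrable fun s : ℝ => ‖Complex.Gamma (1 / 4 + I * s / 2)‖ ^ 2 := by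
  simpa using integrable_abs_pow_mul_normSq_Gamma_quarter 0

/-! ### The kernel `(e^v + e^{−v})^{−1/2}` -/

/-- `v ↦ (e^v + e^{-v})^{-1/2}` is continuous. [folklore] -/
private theorem continuous_sechHalf :
    Continuous fun v : ℝ => (((Real.sqrt (Real.exp v + Real.exp (-v)))⁻¹ : ℝ) : ℂ) := by
  refine Complex.continuous_ofReal.comp ?_
  refine Continuous.inv₀ (by fun_prop) fun v => ?_
  exact (Real.sqrt_pos.2 (by positivity)).ne'

/-- `(e^v + e^{-v})^{-1/2} ≤ e^{-|v|/2}`. [folklore] -/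
private theorem sechHalf_le (v : ℝ) :
    (Real.sqrt (Real.exp v + Real.exp (-v)))⁻¹ ≤ Real.exp (-(1 / 2 * |v|)) := by
  have h1 : Real.exp |v| ≤ Real.exp v + Real.exp (-v) := by
    rcases le_or_gt 0 v with hv | hv
    · rw [abs_of_nonneg hv]; linarith [Real.exp_pos (-v)]
    · rw [abs_of_neg hv]; linarith [Real.exp_pos v]
  have h2 : Real.exp (1 / 2 * |v|) ≤ Real.sqrt (Real.exp v + Real.exp (-v)) := by
    rw [show Real.exp (1 / 2 * |v|) = Real.sqrt (Real.exp |v|) by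
      rw [Real.sqrt_eq_rpow, ← Real.exp_mul]; ring_nf]
    exact Real.sqrt_le_sqrt h1
  rw [show Real.exp (-(1 / 2 * |v|)) = (Real.exp (1 / 2 * |v|))⁻¹ from Real.exp_neg _]
  exact inv_anti₀ (Real.exp_pos _) h2

/-- `v ↦ (e^v + e^{-v})^{-1/2}` is integrable. [folklore] -/
private theorem integrable_sechHalf :
    Integrable fun v : ℝ => (((Real.sqrt (Real.exp v + Real.exp (-v)))⁻¹ : ℝ) : ℂ) := by
  refine (integrable_exp_neg_mul_abs (a := 1 / 2) (by norm_num)).ofReal.mono'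
    continuous_sechHalf.aestronglyMeasurable (Eventually.of_forall fun v => ?_)
  rw [Complex.norm_real, Real.norm_of_nonneg (inv_nonneg.2 (Real.sqrt_nonneg _))]
  simpa using sechHalf_le v

/-! ### Euler's Beta integral and the logistic substitution -/

/-- For a positive real `r`, `r^w = exp(w log r)` with the real logarithm. [folklore] -/
private theorem ofReal_cpow_eq_exp {r : ℝ} (hr : 0 < r) (w : ℂ) :
    ((r : ℝ) : ℂ) ^ w = cexp ((Real.log r : ℂ) * w) := by
  rw [Complex.cpow_def_of_ne_zero (Complex.ofReal_ne_zero.2 hr.ne'), Complex.ofReal_log hr.le]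

/-- The logistic function as a symmetric quotient: `σ(y) = e^{y/2}/(e^{y/2} + e^{-y/2})`. [folklore] -/
private theorem sigmoid_eq_div (y : ℝ) :
    Real.sigmoid y = Real.exp (y / 2) / (Real.exp (y / 2) + Real.exp (-(y / 2))) := by
  rw [Real.sigmoid_def]
  have h1 : Real.exp (-y) = Real.exp (-(y / 2)) / Real.exp (y / 2) := by
    rw [div_eq_mul_inv, ← Real.exp_neg, ← Real.exp_add]; ring_nf
  rw [h1]
  have h2 : Real.exp (y / 2) ≠ 0 := (Real.exp_pos _).ne'
  field_simp

/-- **The integrand after the substitution `x = σ(y)`**: with `w = ¼ + is/2`, `w̄ = ¼ − is/2`,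
`σ(y)^w σ(−y)^{w̄} = (e^{y/2} + e^{−y/2})^{−1/2} e^{isy/2}`. [folklore] -/
private theorem sigmoid_cpow_mul_sigmoid_neg_cpow (s y : ℝ) :
    ((Real.sigmoid y : ℝ) : ℂ) ^ (1 / 4 + I * s / 2 : ℂ) *
        ((Real.sigmoid (-y) : ℝ) : ℂ) ^ (1 / 4 - I * s / 2 : ℂ) =
      (((Real.sqrt (Real.exp (y / 2) + Real.exp (-(y / 2))))⁻¹ : ℝ) : ℂ) * cexp (I * s * y / 2) := by
  set C : ℝ := Real.exp (y / 2) + Real.exp (-(y / 2)) with hC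
  have hCpos : 0 < C := by positivity
  have ha : Real.sigmoid y = Real.exp (y / 2) / C := sigmoid_eq_div y
  have hb : Real.sigmoid (-y) = Real.exp (-(y / 2)) / C := by
    rw [sigmoid_eq_div (-y), hC, neg_div, neg_neg, add_comm]
  have hla : Real.log (Real.sigmoid y) = y / 2 - Real.log C := by
    rw [ha, Real.log_div (Real.exp_pos _).ne' hCpos.ne', Real.log_exp]
  have hlb : Real.log (Real.sigmoid (-y)) = -(y / 2) - Real.log C := by
    rw [hb, Real.log_div (Real.exp_pos _).ne' hCpos.ne', Real.log_exp]
  rw [ofReal_cpow_eq_exp (Real.sigmoid_pos y), ofReal_cpow_eq_exp (Real.sigmoid_pos (-y)), hla, hlb,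
    ← Complex.exp_add]
  have hsq : ((Real.sqrt C)⁻¹ : ℝ) = Real.exp (-(Real.log C / 2)) := by
    rw [Real.sqrt_eq_rpow, Real.rpow_def_of_pos hCpos, ← Real.exp_neg]; ring_nf
  rw [hsq, Complex.ofReal_exp, ← Complex.exp_add]
  congr 1
  push_cast
  ring

/-- **Euler's Beta integral along the logistic substitution**:
`B(¼ + is/2, ¼ − is/2) = ∫_ℝ (e^{y/2} + e^{−y/2})^{−1/2} e^{isy/2} dy`. [cite: ConnesConsaniMoscovici2024, §5.2 Prop. (moments1) proof p0018:L129–L148] -/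
theorem betaIntegral_quarter_eq_integral (s : ℝ) :
    Complex.betaIntegral (1 / 4 + I * s / 2) (1 / 4 - I * s / 2) =
      ∫ y : ℝ, (((Real.sqrt (Real.exp (y / 2) + Real.exp (-(y / 2))))⁻¹ : ℝ) : ℂ) *
        cexp (I * s * y / 2) := by
  rw [Complex.betaIntegral, intervalIntegral.integral_of_le zero_le_one, integral_Ioc_eq_integral_Ioo,
    ← Real.range_sigmoid, ← image_univ,
    integral_image_eq_integral_abs_deriv_smul MeasurableSet.univ
      (fun y _ => (Real.hasDerivAt_sigmoid y).hasDerivWithinAt) Real.sigmoid_injective.injOn,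
    Measure.restrict_univ]
  refine integral_congr_ae (Eventually.of_forall fun y => ?_)
  simp only []
  have ha : 0 < Real.sigmoid y := Real.sigmoid_pos y
  have hb : 0 < 1 - Real.sigmoid y := by linarith [Real.sigmoid_lt_one y]
  have ha' : ((Real.sigmoid y : ℝ) : ℂ) ≠ 0 := Complex.ofReal_ne_zero.2 ha.ne'
  have hb' : ((1 - Real.sigmoid y : ℝ) : ℂ) ≠ 0 := Complex.ofReal_ne_zero.2 hb.ne'
  rw [abs_of_pos (mul_pos ha hb), Complex.real_smul, ← sigmoid_cpow_mul_sigmoid_neg_cpow s y,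
    Real.sigmoid_neg]
  -- `(a b) · a^{w-1} (1-a)^{w̄-1} = a^w (1-a)^{w̄}`
  have e1 : ((Real.sigmoid y : ℝ) : ℂ) ^ (1 / 4 + I * s / 2 : ℂ) =
      ((Real.sigmoid y : ℝ) : ℂ) * ((Real.sigmoid y : ℝ) : ℂ) ^ (1 / 4 + I * s / 2 - 1 : ℂ) := by
    conv_lhs => rw [show (1 / 4 + I * s / 2 : ℂ) = (1 / 4 + I * s / 2 - 1) + 1 by ring,
      Complex.cpow_add _ _ ha', Complex.cpow_one, mul_comm]
  have e2 : ((1 - Real.sigmoid y : ℝ) : ℂ) ^ (1 / 4 - I * s / 2 : ℂ) =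
      ((1 - Real.sigmoid y : ℝ) : ℂ) * ((1 - Real.sigmoid y : ℝ) : ℂ) ^ (1 / 4 - I * s / 2 - 1 : ℂ) := by
    conv_lhs => rw [show (1 / 4 - I * s / 2 : ℂ) = (1 / 4 - I * s / 2 - 1) + 1 by ring,
      Complex.cpow_add _ _ hb', Complex.cpow_one, mul_comm]
  rw [e1, e2]
  push_cast
  ring

/-- `√π = π^{1/2}` in `ℂ`. [folklore] -/
private theorem ofReal_sqrt_pi : ((Real.sqrt π : ℝ) : ℂ) = (π : ℂ) ^ (1 / 2 : ℂ) := by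
  rw [Real.sqrt_eq_rpow, Complex.ofReal_cpow Real.pi_pos.le]; push_cast; rfl

/-- **`|Γ(¼ + is/2)|²` as a Fourier integral**:
`|Γ(¼ + is/2)|² = Γ(¼ + is/2)Γ(¼ − is/2) = Γ(½) B(¼ + is/2, ¼ − is/2) = 2√π ∫_ℝ (e^v + e^{−v})^{−1/2} e^{isv} dv`.
[cite: ConnesConsaniMoscovici2024, §5.2 Prop. (moments1) proof p0018:L129–L148] -/
theorem normSq_Gamma_quarter_eq_integral (s : ℝ) :
    ((‖Complex.Gamma (1 / 4 + I * s / 2)‖ ^ 2 : ℝ) : ℂ) =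
      2 * (Real.sqrt π : ℂ) *
        ∫ v : ℝ, (((Real.sqrt (Real.exp v + Real.exp (-v)))⁻¹ : ℝ) : ℂ) * cexp (I * s * v) := by
  -- `|Γ(w)|² = Γ(w) Γ(w̄)`
  have hconj : (1 / 4 - I * s / 2 : ℂ) = (starRingEnd ℂ) (1 / 4 + I * s / 2) := by
    simp only [map_add, map_div₀, map_mul, Complex.conj_I, Complex.conj_ofReal, map_one, map_ofNat]
    ring
  have h1 : ((‖Complex.Gamma (1 / 4 + I * s / 2)‖ ^ 2 : ℝ) : ℂ) =
      Complex.Gamma (1 / 4 + I * s / 2) * Complex.Gamma (1 / 4 - I * s / 2) := by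
    rw [hconj, Complex.Gamma_conj, Complex.mul_conj, Complex.normSq_eq_norm_sq, Complex.ofReal_pow]
  rw [h1, Complex.Gamma_mul_Gamma_eq_betaIntegral (by simp) (by simp),
    show (1 / 4 + I * s / 2 + (1 / 4 - I * s / 2) : ℂ) = 1 / 2 by ring, Complex.Gamma_one_half_eq,
    ← ofReal_sqrt_pi, betaIntegral_quarter_eq_integral]
  -- `y = 2v`
  have hsub := Measure.integral_comp_mul_left
    (fun y : ℝ => (((Real.sqrt (Real.exp (y / 2) + Real.exp (-(y / 2))))⁻¹ : ℝ) : ℂ) *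
      cexp (I * s * y / 2)) (2 : ℝ)
  have h2 : ∫ y : ℝ, (((Real.sqrt (Real.exp (y / 2) + Real.exp (-(y / 2))))⁻¹ : ℝ) : ℂ) *
      cexp (I * s * y / 2) =
      2 * ∫ v : ℝ, (((Real.sqrt (Real.exp v + Real.exp (-v)))⁻¹ : ℝ) : ℂ) * cexp (I * s * v) := by
    have e : (fun v : ℝ => (((Real.sqrt (Real.exp (2 * v / 2) + Real.exp (-(2 * v / 2))))⁻¹ : ℝ) : ℂ) *
        cexp (I * s * ((2 : ℝ) * v : ℝ) / 2)) =
        fun v : ℝ => (((Real.sqrt (Real.exp v + Real.exp (-v)))⁻¹ : ℝ) : ℂ) * cexp (I * s * v) := by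
      funext v
      rw [show (2 : ℝ) * v / 2 = v by ring]
      congr 2; push_cast; ring
    rw [← e]
    rw [hsub, abs_inv, abs_two, Complex.real_smul]
    push_cast
    ring
  rw [h2]
  ring

/-- The same identity in terms of Mathlib's Fourier transform `𝓕` (kernel `e^{−2πivξ}`), evaluated at
`ξ = −s/(2π)`. [cite: ConnesConsaniMoscovici2024, §5.2 Prop. (moments1) proof p0018:L129–L148] -/
theorem normSq_Gamma_quarter_eq_fourier (s : ℝ) :
    ((‖Complex.Gamma (1 / 4 + I * s / 2)‖ ^ 2 : ℝ) : ℂ) =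
      2 * (Real.sqrt π : ℂ) *
        𝓕 (fun v : ℝ => (((Real.sqrt (Real.exp v + Real.exp (-v)))⁻¹ : ℝ) : ℂ)) (-s / (2 * π)) := by
  rw [normSq_Gamma_quarter_eq_integral, Real.fourier_real_eq_integral_exp_smul]
  congr 1
  refine integral_congr_ae (Eventually.of_forall fun v => ?_)
  simp only [smul_eq_mul]
  rw [mul_comm (cexp _)]
  congr 1
  have hπ : (π : ℝ) ≠ 0 := Real.pi_ne_zero
  rw [show (-2 * π * v * (-s / (2 * π))) = s * v by field_simp]
  push_cast
  ring_nf

/-- The Fourier transform of `(e^v + e^{−v})^{−1/2}` is `(2√π)⁻¹|Γ(¼ − iπξ… )|²`, explicitly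
`𝓕h(ξ) = (2√π)⁻¹ |Γ(¼ + i(−2πξ)/2)|²`; in particular it is integrable. [cite: ConnesConsaniMoscovici2024, §5.2 Prop. (moments1) proof p0018:L129–L148] -/
theorem fourier_sechHalf_eq (ξ : ℝ) :
    𝓕 (fun v : ℝ => (((Real.sqrt (Real.exp v + Real.exp (-v)))⁻¹ : ℝ) : ℂ)) ξ =
      (2 * (Real.sqrt π : ℂ))⁻¹ *
        ((‖Complex.Gamma (1 / 4 + I * ((-2 * π * ξ : ℝ) : ℂ) / 2)‖ ^ 2 : ℝ) : ℂ) := by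
  have h := normSq_Gamma_quarter_eq_fourier (-2 * π * ξ)
  have hπ : (π : ℝ) ≠ 0 := Real.pi_ne_zero
  rw [show (-(-2 * π * ξ) / (2 * π)) = ξ by field_simp] at h
  have hne : (2 * (Real.sqrt π : ℂ)) ≠ 0 := by
    have : (0 : ℝ) < Real.sqrt π := Real.sqrt_pos.2 Real.pi_pos
    exact mul_ne_zero two_ne_zero (by exact_mod_cast this.ne')
  rw [h, ← mul_assoc, inv_mul_cancel₀ hne, one_mul]

/-- The Fourier transform of `(eᵛ+e⁻ᵛ)^{−1/2}` is integrable (it is `(2√π)⁻¹|Γ(¼ − iπξ)|²`).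
[cite: ConnesConsaniMoscovici2024, §5.2 Prop. (moments1) proof p0018:L129–L148] -/
theorem integrable_fourier_sechHalf :
    Integrable (𝓕 (fun v : ℝ => (((Real.sqrt (Real.exp v + Real.exp (-v)))⁻¹ : ℝ) : ℂ))) := by
  have h : 𝓕 (fun v : ℝ => (((Real.sqrt (Real.exp v + Real.exp (-v)))⁻¹ : ℝ) : ℂ)) =
      fun ξ : ℝ => (2 * (Real.sqrt π : ℂ))⁻¹ *
        (((fun s : ℝ => ‖Complex.Gamma (1 / 4 + I * s / 2)‖ ^ 2) (-2 * π * ξ) : ℝ) : ℂ) := by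
    funext ξ; rw [fourier_sechHalf_eq]
  rw [h]
  have hπ : (-2 * π : ℝ) ≠ 0 := by have := Real.pi_pos; linarith
  exact ((integrable_normSq_Gamma_quarter.comp_mul_left' hπ).ofReal).const_mul _

/-! ### The characteristic function of `|Γ(¼ + is/2)|² ds` -/

/-- **`∫ e^{isx}|Γ(¼ + is/2)|² ds = 4π^{3/2}(e^x + e^{−x})^{−1/2}`** — the Beta identity, the
substitution `s = −2πσ` and Fourier inversion for the continuous integrable kernel
`(e^v + e^{−v})^{−1/2}` (whose transform `(2√π)⁻¹|Γ(¼ − iπσ)|²` is integrable). [cite: ConnesConsaniMoscovici2024, §5.2 Prop. (moments1) proof p0018:L129–L148] -/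
theorem integral_normSq_Gamma_quarter_mul_exp (x : ℝ) :
    ∫ s : ℝ, ((‖Complex.Gamma (1 / 4 + I * s / 2)‖ ^ 2 : ℝ) : ℂ) * cexp (I * s * x) =
      4 * (π : ℂ) * (Real.sqrt π : ℂ) * (((Real.sqrt (Real.exp x + Real.exp (-x)))⁻¹ : ℝ) : ℂ) := by
  set h : ℝ → ℂ := fun v => (((Real.sqrt (Real.exp v + Real.exp (-v)))⁻¹ : ℝ) : ℂ) with hh
  set G : ℝ → ℂ := fun σ => cexp (↑(-2 * π * σ * x) * I) • 𝓕 h σ with hG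
  have hπ : (π : ℝ) ≠ 0 := Real.pi_ne_zero
  have h1 : (fun s : ℝ => ((‖Complex.Gamma (1 / 4 + I * s / 2)‖ ^ 2 : ℝ) : ℂ) * cexp (I * s * x)) =
      fun s : ℝ => 2 * (Real.sqrt π : ℂ) * G (-(2 * π)⁻¹ * s) := by
    funext s
    rw [normSq_Gamma_quarter_eq_fourier, hG]
    simp only [smul_eq_mul]
    rw [show (-(2 * π)⁻¹ * s) = -s / (2 * π) by ring]
    have e : cexp (↑(-2 * π * (-s / (2 * π)) * x) * I) = cexp (I * s * x) := by
      congr 1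
      rw [show (-2 * π * (-s / (2 * π)) * x) = s * x by field_simp]
      push_cast; ring
    rw [e]; ring
  rw [h1, integral_const_mul, Measure.integral_comp_mul_left G, hG,
    ← Real.fourier_real_eq_integral_exp_smul]
  -- Fourier inversion: `𝓕 (𝓕 h) x = 𝓕⁻ (𝓕 h) (-x) = h (-x) = h x`
  have hinv : 𝓕 (𝓕 h) x = h x := by
    have hI := Continuous.fourierInv_fourier_eq continuous_sechHalf integrable_sechHalf
      integrable_fourier_sechHalf
    rw [show x = -(-x) by ring, ← Real.fourierInv_eq_fourier_neg, hI, hh]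
    simp only [neg_neg]
    rw [add_comm]
  rw [hinv, inv_neg, inv_inv, abs_neg, abs_of_pos (by positivity : (0 : ℝ) < 2 * π),
    Complex.real_smul, hh]
  push_cast
  ring

/-- The numerical constant: `(2π)^{−3/2} · 4π√π = √2`. [folklore] -/
private theorem const_eq_sqrt_two : (2 * π) ^ (-(3 : ℝ) / 2) * (4 * π * Real.sqrt π) = Real.sqrt 2 := by
  have h2π : (0 : ℝ) < 2 * π := by positivity
  have e1 : (2 * π) ^ (-(3 : ℝ) / 2) = ((2 * π) * Real.sqrt (2 * π))⁻¹ := by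
    rw [show (-(3 : ℝ) / 2) = -(1 + 1 / 2) by norm_num, Real.rpow_neg h2π.le,
      Real.rpow_add h2π, Real.rpow_one, Real.sqrt_eq_rpow]
  have e2 : Real.sqrt (2 * π) = Real.sqrt 2 * Real.sqrt π := Real.sqrt_mul (by norm_num) π
  have hs2 : Real.sqrt 2 ≠ 0 := (Real.sqrt_pos.2 (by norm_num)).ne'
  have hsπ : Real.sqrt π ≠ 0 := (Real.sqrt_pos.2 Real.pi_pos).ne'
  have hπ : (π : ℝ) ≠ 0 := Real.pi_ne_zero
  rw [e1, e2]
  calc (2 * π * (Real.sqrt 2 * Real.sqrt π))⁻¹ * (4 * π * Real.sqrt π) = 2 / Real.sqrt 2 := by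
        field_simp
        ring
    _ = Real.sqrt 2 := Real.div_sqrt

/-- The density `(2π)^{−3/2}|Γ(¼ + is/2)|²` is even in `s`. [folklore] -/
private theorem density_neg (s : ℝ) :
    (2 * Real.pi) ^ (-(3 : ℝ) / 2) * ‖Complex.Gamma (1 / 4 + I * ((-s : ℝ) : ℂ) / 2)‖ ^ 2 =
      (2 * Real.pi) ^ (-(3 : ℝ) / 2) * ‖Complex.Gamma (1 / 4 + I * s / 2)‖ ^ 2 := by
  rw [norm_Gamma_quarter_neg]

/-- The density is nonnegative. [folklore] -/
private theorem density_nonneg (s : ℝ) :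
    0 ≤ (2 * Real.pi) ^ (-(3 : ℝ) / 2) * ‖Complex.Gamma (1 / 4 + I * s / 2)‖ ^ 2 := by
  positivity

/-- The density is measurable (indeed continuous). [folklore] -/
private theorem measurable_density :
    Measurable fun s : ℝ => (2 * Real.pi) ^ (-(3 : ℝ) / 2) * ‖Complex.Gamma (1 / 4 + I * s / 2)‖ ^ 2 :=
  (continuous_const.mul (continuous_Gamma_quarter.norm.pow 2)).measurable

/-- Integration against `dm = (2π)^{−3/2}|Γ(¼+is/2)|² ds` is integration against the density. [folklore] -/
private theorem integral_gammaQuarterMeasure (g : ℝ → ℂ) :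
    ∫ s, g s ∂gammaQuarterMeasure =
      ∫ s : ℝ, (((2 * Real.pi) ^ (-(3 : ℝ) / 2) * ‖Complex.Gamma (1 / 4 + I * s / 2)‖ ^ 2 : ℝ) : ℂ) *
        g s := by
  rw [gammaQuarterMeasure, integral_withDensity_eq_integral_toReal_smul measurable_density.ennreal_ofReal
    (Eventually.of_forall fun _ => ENNReal.ofReal_lt_top)]
  refine integral_congr_ae (Eventually.of_forall fun s => ?_)
  simp only []
  rw [ENNReal.toReal_ofReal (density_nonneg s), Complex.real_smul]

/-- **The characteristic function of `dm`**: `∫ e^{isx} dm(s) = √(2/(e^x + e^{−x}))` for every real `x`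
(CCM 2024, §5.2, Prop. «(moments1)», the displayed computation p0018:L129–L148: printed via the
Mellin–Plancherel theorem for `𝔽_μ(wξ)`, `ξ` Gaussian; here via Euler's Beta integral and Fourier
inversion, which is the road Mathlib supports — the identity proved is the printed one).
[cite: ConnesConsaniMoscovici2024, §5.2 Prop. (moments1) p0018:L121–L148] -/
theorem integral_cexp_gammaQuarterMeasure (x : ℝ) :
    ∫ s, Complex.exp (I * s * x) ∂gammaQuarterMeasure =
      (Real.sqrt (2 / (Real.exp x + Real.exp (-x))) : ℂ) := by
  rw [integral_gammaQuarterMeasure]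
  have h1 : (fun s : ℝ => (((2 * Real.pi) ^ (-(3 : ℝ) / 2) *
      ‖Complex.Gamma (1 / 4 + I * s / 2)‖ ^ 2 : ℝ) : ℂ) * cexp (I * s * x)) =
      fun s : ℝ => (((2 * Real.pi) ^ (-(3 : ℝ) / 2) : ℝ) : ℂ) *
        (((‖Complex.Gamma (1 / 4 + I * s / 2)‖ ^ 2 : ℝ) : ℂ) * cexp (I * s * x)) := by
    funext s; push_cast; ring
  rw [h1, integral_const_mul, integral_normSq_Gamma_quarter_mul_exp]
  have hE : 0 < Real.exp x + Real.exp (-x) := by positivity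
  rw [Real.sqrt_div' 2 hE.le, div_eq_mul_inv, ← const_eq_sqrt_two]
  push_cast
  ring

/-- **Total mass**: `∫ (2π)^{−3/2}|Γ(¼ + is/2)|² ds = 1`. [cite: ConnesConsaniMoscovici2024, Thm 3.1 (ii) p0008:L139; §5.2 Prop. (moments1) p0018:L123–L129] -/
theorem integral_gammaQuarterDensity :
    ∫ s : ℝ, (2 * Real.pi) ^ (-(3 : ℝ) / 2) * ‖Complex.Gamma (1 / 4 + I * s / 2)‖ ^ 2 = 1 := by
  have h := integral_cexp_gammaQuarterMeasure 0
  rw [integral_gammaQuarterMeasure] at h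
  simp only [Complex.ofReal_zero, mul_zero, Complex.exp_zero, mul_one, Real.exp_zero, neg_zero] at h
  rw [integral_complex_ofReal, show (2 : ℝ) / (1 + 1) = 1 by norm_num, Real.sqrt_one] at h
  exact_mod_cast h

/-- **`dm` is a probability measure.** [cite: ConnesConsaniMoscovici2024, Thm 3.1 (ii) p0008:L139; Thm 5.2 (iii) p0018:L71] -/
theorem isProbabilityMeasure_gammaQuarterMeasure : IsProbabilityMeasure gammaQuarterMeasure := by
  refine ⟨?_⟩
  rw [gammaQuarterMeasure, withDensity_apply _ MeasurableSet.univ, Measure.restrict_univ,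
    ← ofReal_integral_eq_lintegral_ofReal
      ((integrable_normSq_Gamma_quarter.const_mul _)) (Eventually.of_forall density_nonneg),
    integral_gammaQuarterDensity, ENNReal.ofReal_one]

/-- The same for the spelling `htMeasure` of §3 (`gammaQuarterMeasure = htMeasure`): the conjunct
`IsProbabilityMeasure htMeasure` of `CCM2024_thm_3_1_ii`. [cite: ConnesConsaniMoscovici2024, Thm 3.1 (ii) p0008:L139] -/
theorem isProbabilityMeasure_htMeasure : IsProbabilityMeasure htMeasure := by
  rw [← gammaQuarterMeasure_eq_htMeasure]; exact isProbabilityMeasure_gammaQuarterMeasure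

/-! ### Moments -/

/-- **All moments of `dm` exist**: `s ↦ sⁿ` is `dm`-integrable. [cite: ConnesConsaniMoscovici2024, §5.2 p0018:L89–L109] -/
theorem integrable_pow_gammaQuarterMeasure (n : ℕ) :
    Integrable (fun s : ℝ => s ^ n) gammaQuarterMeasure := by
  rw [gammaQuarterMeasure, integrable_withDensity_iff_integrable_smul' measurable_density.ennreal_ofReal
    (Eventually.of_forall fun _ => ENNReal.ofReal_lt_top)]
  refine ((integrable_abs_pow_mul_normSq_Gamma_quarter n).const_mul ((2 * Real.pi) ^ (-(3 : ℝ) / 2))).mono'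
    ?_ (Eventually.of_forall fun s => ?_)
  · exact (measurable_density.ennreal_ofReal.ennreal_toReal.aestronglyMeasurable.smul
      (continuous_pow n).aestronglyMeasurable)
  · rw [ENNReal.toReal_ofReal (density_nonneg s), norm_smul, norm_pow,
      Real.norm_of_nonneg (density_nonneg s), Real.norm_eq_abs]
    exact le_of_eq (by ring)

/-- **The odd moments of `dm` vanish** (the density is even). [cite: ConnesConsaniMoscovici2024, §5.2 Prop. (moments1) p0018:L123] -/
theorem integral_pow_gammaQuarterMeasure_of_odd {n : ℕ} (hn : Odd n) :
    ∫ s, ((s : ℂ) ^ n) ∂gammaQuarterMeasure = 0 := by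
  rw [integral_gammaQuarterMeasure]
  set F : ℝ → ℂ := fun s => (((2 * Real.pi) ^ (-(3 : ℝ) / 2) *
    ‖Complex.Gamma (1 / 4 + I * s / 2)‖ ^ 2 : ℝ) : ℂ) * (s : ℂ) ^ n with hF
  have hodd : (fun s : ℝ => F (-s)) = fun s => -F s := by
    funext s
    simp only [hF]
    rw [density_neg s, Complex.ofReal_neg, hn.neg_pow]
    ring
  have h1 : ∫ s, F s = -∫ s, F s := by
    conv_lhs => rw [← integral_neg_eq_self F volume]
    rw [hodd, integral_neg]
  have h2 : (2 : ℂ) * ∫ s, F s = 0 := by linear_combination h1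
  simpa using h2

/-- **CCM 2024, §5.2, Proposition «(moments1)» DISCHARGED**: `dm = (2π)^{−3/2}|Γ(¼ + is/2)|² ds` is a
probability measure, its odd moments vanish, and `∫ e^{isx} dm(s) = √(2/(e^x + e^{−x}))`.
[cite: ConnesConsaniMoscovici2024, §5.2 Prop. (moments1) p0018:L121–L148] -/
theorem CCM2024_prop_moments_sech_holds : CCM2024_prop_moments_sech :=
  ⟨isProbabilityMeasure_gammaQuarterMeasure,
    fun _ hn => ⟨integrable_pow_gammaQuarterMeasure _, integral_pow_gammaQuarterMeasure_of_odd hn⟩,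
    integral_cexp_gammaQuarterMeasure⟩

end Literature.NumberTheory.ConnesConsani2024
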